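import Literature.Probability.Percolation.HierarchicalNoRunaway
import Literature.Probability.Percolation.TruncatedSusceptibility
import Mathlib.Analysis.Complex.ExponentialBounds
import HarnessLib

/-!
# Hierarchical long-range percolation: renormalisation of the restricted susceptibility (Hutchcroft 2022, Lemma 2.8)

Topic `Literature/Probability/Percolation`. Theorem-only sequel of `HierarchicalNoRunaway.lean`
(Prop. 2.4) and `TruncatedSusceptibility.lean` (Lemma 2.9), toward the named fact
`Hutchcroft2022_twoPoint_volumeTail`:

* `prodBernoulli_real_biUnion_inter_eq_sum` — exact decomposition `P(⋃ A_v ∩ B_v) = Σ P(A_v)P(B_v)`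
  through a finite set of coordinates; `prodBernoulli_harris_sum`,
  `prodBernoulli_integral_stepFun_mul_ge` — Harris' inequality for increasing step functions;
* `hierLaw_real_reachable_parent_ge` — for `x ∈ B`, `y ∈ B'` (distinct children of `σ(B)`),
  `P(x ↔ y in η_{σ(B)}) ≥ (1-e^{-1}) h E[|K_B(x)∩B| ∧ τ] E[|K_{B'}(y)∩B'| ∧ τ]`, `h = cβL^{-(d+α)(n+1)}`,
  `hτ² ≤ 1` ((2.13)–(2.14) and Harris);
* `Mblock_le_parent` (`M_B ≤ M_{σ(B)}`) and **`sumConn_parent_ge`** — Lemma 2.8 in explicit form: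
  `Σ_{σ(B)} ≥ ¼(1-e^{-1}) h κ_B κ_{B'} Σ_B Σ_{B'}` with `κ_C = min(1, τ/(10 M_C))`.

## References

* [Hutchcroft2022] T. Hutchcroft, J. Math. Phys. 63 (2022), arXiv:2202.07634, Lemma 2.8 and its
  proof (pp. 11–12), (2.13), (2.14).
-/

noncomputable section

namespace Literature.Probability.Percolation

open Finset MeasureTheory Literature.Probability.LatticeModels

variable {d : ℕ}

/-! ### Exact decomposition through finitely many coordinates; Harris for step functions -/

section ExactDecomposition

variable {ι : Type*}

/-- **Exact decomposition through a finite set of coordinates**: for finitely many pairwise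
disjoint events `A_v` determined by `Tᶜ` and events `B_v` determined by `T`,
`P(⋃_v A_v ∩ B_v) = Σ_v P(A_v) P(B_v)` ("conditional on `𝓕`, each set `C' ∈ 𝒞'` is connected
to `C(x)` by an edge of `ω_{σ(B)}` with probability `1 - exp(-h|C'|·|C(x)|)`").
[cite: Hutchcroft2022, proof of Lemma 2.8 (2.13)] -/
theorem prodBernoulli_real_biUnion_inter_eq_sum {δ : Type*} (p : ι → unitInterval) (T : Finset ι)
    (S : Finset δ) (A B : δ → Set (Set ι)) (hA : ∀ v ∈ S, DeterminedBy (A v) (↑T : Set ι)ᶜ)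
    (hB : ∀ v ∈ S, DeterminedBy (B v) (↑T : Set ι)) (hAm : ∀ v ∈ S, MeasurableSet (A v))
    (hBm : ∀ v ∈ S, MeasurableSet (B v)) (hdisj : (↑S : Set δ).PairwiseDisjoint A) :
    (prodBernoulli p).real (⋃ v ∈ S, A v ∩ B v) =
      ∑ v ∈ S, (prodBernoulli p).real (A v) * (prodBernoulli p).real (B v) := by
  rw [measureReal_biUnion_finset]
  · refine Finset.sum_congr rfl fun v hv => ?_
    rw [Set.inter_comm, prodBernoulli_real_inter_of_determinedBy p T (hB v hv) (hA v hv) (hBm v hv)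
      (hAm v hv), mul_comm]
  · intro v hv w hw hne
    exact (hdisj hv hw hne).mono Set.inter_subset_left Set.inter_subset_left
  · intro v hv; exact (hAm v hv).inter (hBm v hv)

/-- **Harris' inequality for nonnegative combinations of increasing events**:
`(Σ_s a_s P(A_s)) (Σ_t b_t P(B_t)) ≤ Σ_{s,t} a_s b_t P(A_s ∩ B_t)` (`a, b ≥ 0`, `A_s, B_t`
increasing measurable), i.e. `E f · E g ≤ E[f g]` for the increasing step functions
`f = Σ a_s 𝟙_{A_s}`, `g = Σ b_t 𝟙_{B_t}` ("we may apply the Harris-FKG inequality to take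
expectations"). [cite: Hutchcroft2022, proof of Lemma 2.8 (p. 12)] -/
theorem prodBernoulli_harris_sum (p : ι → unitInterval) {κ κ' : Type*} (S : Finset κ)
    (S' : Finset κ') (a : κ → ℝ) (b : κ' → ℝ) (A : κ → Set (Set ι)) (B : κ' → Set (Set ι))
    (ha : ∀ s ∈ S, 0 ≤ a s) (hb : ∀ t ∈ S', 0 ≤ b t) (hA : ∀ s ∈ S, IsUpperSet (A s))
    (hAm : ∀ s ∈ S, MeasurableSet (A s)) (hB : ∀ t ∈ S', IsUpperSet (B t))
    (hBm : ∀ t ∈ S', MeasurableSet (B t)) :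
    (∑ s ∈ S, a s * (prodBernoulli p).real (A s)) * (∑ t ∈ S', b t * (prodBernoulli p).real (B t)) ≤
      ∑ s ∈ S, ∑ t ∈ S', a s * b t * (prodBernoulli p).real (A s ∩ B t) := by
  rw [Finset.sum_mul_sum]
  refine Finset.sum_le_sum fun s hs => Finset.sum_le_sum fun t ht => ?_
  have h := prodBernoulli_harris p (hA s hs) (hB t ht) (hAm s hs) (hBm t ht)
  have := mul_le_mul_of_nonneg_left h (mul_nonneg (ha s hs) (hb t ht))
  linarith [this]

/-- The integral of a product of two step functions. [folklore] -/
theorem integral_stepFun_mul_stepFun {Ω : Type*} [MeasurableSpace Ω] (μ : Measure Ω) [IsFiniteMeasure μ]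
    {κ κ' : Type*} (S : Finset κ) (S' : Finset κ') (a : κ → ℝ) (b : κ' → ℝ) (A : κ → Set Ω)
    (B : κ' → Set Ω) (hAm : ∀ s ∈ S, MeasurableSet (A s)) (hBm : ∀ t ∈ S', MeasurableSet (B t)) :
    ∫ ω, (∑ s ∈ S, a s * (A s).indicator (fun _ => (1 : ℝ)) ω) *
        (∑ t ∈ S', b t * (B t).indicator (fun _ => (1 : ℝ)) ω) ∂μ =
      ∑ s ∈ S, ∑ t ∈ S', a s * b t * μ.real (A s ∩ B t) := by
  have hpt : ∀ ω, (∑ s ∈ S, a s * (A s).indicator (fun _ => (1 : ℝ)) ω) *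
      (∑ t ∈ S', b t * (B t).indicator (fun _ => (1 : ℝ)) ω) =
      ∑ s ∈ S, ∑ t ∈ S', a s * b t * (A s ∩ B t).indicator (fun _ => (1 : ℝ)) ω := by
    intro ω
    rw [Finset.sum_mul_sum]
    refine Finset.sum_congr rfl fun s _ => Finset.sum_congr rfl fun t _ => ?_
    by_cases h1 : ω ∈ A s
    · by_cases h2 : ω ∈ B t
      · rw [Set.indicator_of_mem h1, Set.indicator_of_mem h2,
          Set.indicator_of_mem (Set.mem_inter h1 h2)]; ring
      · rw [Set.indicator_of_notMem h2,
          Set.indicator_of_notMem (fun h : ω ∈ A s ∩ B t => h2 h.2)]; ring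
    · rw [Set.indicator_of_notMem h1,
        Set.indicator_of_notMem (fun h : ω ∈ A s ∩ B t => h1 h.1)]; ring
  simp_rw [hpt]
  have hint : ∀ s ∈ S, ∀ t ∈ S', Integrable (fun ω => a s * b t * (A s ∩ B t).indicator (fun _ => (1 : ℝ)) ω) μ :=
    fun s hs t ht => ((integrable_const (1 : ℝ)).indicator ((hAm s hs).inter (hBm t ht))).const_mul _
  rw [integral_finsetSum _ fun s hs => integrable_finsetSum _ fun t ht => hint s hs t ht]
  refine Finset.sum_congr rfl fun s hs => ?_
  rw [integral_finsetSum _ fun t ht => hint s hs t ht]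
  refine Finset.sum_congr rfl fun t ht => ?_
  rw [integral_const_mul, integral_indicator_const _ ((hAm s hs).inter (hBm t ht)), smul_eq_mul, mul_one]

/-- **Harris for step functions, integral form**: `E f · E g ≤ E[f g]`. [cite: Hutchcroft2022, proof of Lemma 2.8 (p. 12)] -/
theorem prodBernoulli_integral_stepFun_mul_ge (p : ι → unitInterval) {κ κ' : Type*} (S : Finset κ)
    (S' : Finset κ') (a : κ → ℝ) (b : κ' → ℝ) (A : κ → Set (Set ι)) (B : κ' → Set (Set ι))
    (ha : ∀ s ∈ S, 0 ≤ a s) (hb : ∀ t ∈ S', 0 ≤ b t) (hA : ∀ s ∈ S, IsUpperSet (A s))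
    (hAm : ∀ s ∈ S, MeasurableSet (A s)) (hB : ∀ t ∈ S', IsUpperSet (B t))
    (hBm : ∀ t ∈ S', MeasurableSet (B t)) :
    (∫ ω, ∑ s ∈ S, a s * (A s).indicator (fun _ => (1 : ℝ)) ω ∂(prodBernoulli p)) *
        (∫ ω, ∑ t ∈ S', b t * (B t).indicator (fun _ => (1 : ℝ)) ω ∂(prodBernoulli p)) ≤
      ∫ ω, (∑ s ∈ S, a s * (A s).indicator (fun _ => (1 : ℝ)) ω) *
        (∑ t ∈ S', b t * (B t).indicator (fun _ => (1 : ℝ)) ω) ∂(prodBernoulli p) := by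
  rw [integral_stepFun_mul_stepFun _ S S' a b A B hAm hBm,
    integral_finsetSum _ fun s hs => ((integrable_const (1 : ℝ)).indicator (hAm s hs)).const_mul _,
    integral_finsetSum _ fun t ht => ((integrable_const (1 : ℝ)).indicator (hBm t ht)).const_mul _]
  have h1 : ∀ s ∈ S, ∫ ω, a s * (A s).indicator (fun _ => (1 : ℝ)) ω ∂(prodBernoulli p) =
      a s * (prodBernoulli p).real (A s) := fun s hs => by
    rw [integral_const_mul, integral_indicator_const _ (hAm s hs), smul_eq_mul, mul_one]
  have h2 : ∀ t ∈ S', ∫ ω, b t * (B t).indicator (fun _ => (1 : ℝ)) ω ∂(prodBernoulli p) =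
      b t * (prodBernoulli p).real (B t) := fun t ht => by
    rw [integral_const_mul, integral_indicator_const _ (hBm t ht), smul_eq_mul, mul_one]
  rw [Finset.sum_congr rfl h1, Finset.sum_congr rfl h2]
  exact prodBernoulli_harris_sum p S S' a b A B ha hb hA hAm hB hBm

end ExactDecomposition

section Lemma28

open MeasureTheory

/-- `(1 - e^{-1}) t ≤ 1 - e^{-t}` for `0 ≤ t ≤ 1` (convexity of `exp`). [cite: Hutchcroft2022, proof of Lemma 2.8 ("Using that 1-e^{-t} ≥ (1-e^{-1})t for 0 ≤ t ≤ 1")] -/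
theorem one_sub_exp_neg_one_mul_le {t : ℝ} (h0 : 0 ≤ t) (h1 : t ≤ 1) :
    (1 - Real.exp (-1)) * t ≤ 1 - Real.exp (-t) := by
  have := convexOn_exp.2 (Set.mem_univ (0 : ℝ)) (Set.mem_univ (-1 : ℝ)) (by linarith : 0 ≤ 1 - t) h0
    (by ring)
  simp only [smul_eq_mul, mul_zero, zero_add, Real.exp_zero, mul_one, mul_neg] at this
  linarith

/-- Indicator of a preimage. [folklore] -/
theorem indicator_preimage_const_one {X Y : Type*} (f : X → Y) (E : Set Y) (x : X) :
    (f ⁻¹' E).indicator (fun _ => (1 : ℝ)) x = E.indicator (fun _ => (1 : ℝ)) (f x) := by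
  by_cases h : f x ∈ E
  · rw [Set.indicator_of_mem h, Set.indicator_of_mem (show x ∈ f ⁻¹' E from h)]
  · rw [Set.indicator_of_notMem h, Set.indicator_of_notMem (show x ∉ f ⁻¹' E from h)]

/-- `η_A` is monotone in the labelled configuration. [folklore] -/
theorem etaCfg_mono (A : Set (Sym2 (Site d))) : Monotone (etaCfg (d := d) A) := by
  intro ξ ξ' hle e he
  simp only [etaCfg, Set.mem_setOf_eq] at he ⊢
  exact he.imp (fun h0 => hle h0) fun h1 => ⟨hle h1.1, h1.2⟩

variable {L : ℕ} (hL : 2 ≤ L) (hd : 1 ≤ d) {o : ℕ → Site d} (ho : IsHierOffset L o)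
  {J : Sym2 (Site d) → ℝ} {c α β : ℝ}

include hL hd ho in
/-- **The renormalisation inequality for one pair** (core of Lemma 2.8): for `x ∈ B`, `y ∈ B'`,
distinct children of `σ(B)`, `h = cβL^{-(d+α)(n+1)}` and `τ > 0` with `hτ² ≤ 1`,
`P_{β,σ}(x ↔ y in η_{σ(B)}) ≥ (1 - e^{-1}) h · E[|K_B(x)∩B| ∧ τ] · E[|K_{B'}(y)∩B'| ∧ τ]`
(conditionally on `η_B` the traces `C(x)`, `C'(y)` are joined by an open copy of a pair of `σ(B)`
with probability `1 - exp(-h|C(x)||C'(y)|) ≥ (1-e^{-1}) h (|C(x)| ∧ τ)(|C'(y)| ∧ τ)`, and Harris'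
inequality decouples the two increasing factors). [cite: Hutchcroft2022, proof of Lemma 2.8 (2.13)–(2.14)] -/
theorem hierLaw_real_reachable_parent_ge (hc : 0 ≤ c) (hβ : 0 ≤ β) {n : ℕ} {x₀ : Site d}
    {B B' : Finset (Site d)} (hB : B ∈ children L o n x₀) (hB' : B' ∈ children L o n x₀)
    (hne : B ≠ B') {x y : Site d} (hx : x ∈ B) (hy : y ∈ B') {τ : ℝ} (hτ : 0 < τ)
    (hτh : β * (c * ((L : ℝ) ^ (n + 1)) ^ (-((d : ℝ) + α))) * τ ^ 2 ≤ 1) :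
    (1 - Real.exp (-1)) * (β * (c * ((L : ℝ) ^ (n + 1)) ^ (-((d : ℝ) + α)))) *
        ((∫ ξ, min (clusterCapIn B (etaCfg (aboveFree L o B) ξ) x : ℝ) τ ∂(hierLaw J L o c α β)) *
          (∫ ξ, min (clusterCapIn B' (etaCfg (aboveFree L o B) ξ) y : ℝ) τ ∂(hierLaw J L o c α β))) ≤
      (hierLaw J L o c α β).real
        {ξ | (openGraph (etaCfg (aboveFree L o (block L o (n + 1) x₀)) ξ)).Reachable x y} := by
  classical
  have hL1 : 1 ≤ L := le_trans (by norm_num) hL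
  set μ := hierLaw J L o c α β with hμ
  haveI : IsProbabilityMeasure μ := by rw [hμ]; infer_instance
  set η : Set (Sym2 (Site d) × Fin 2) → BondConfig (Site d) := etaCfg (aboveFree L o B) with hη
  set h : ℝ := β * (c * ((L : ℝ) ^ (n + 1)) ^ (-((d : ℝ) + α))) with hh
  have hh0 : 0 ≤ h := mul_nonneg hβ (mul_nonneg hc (Real.rpow_nonneg (pow_nonneg (Nat.cast_nonneg _) _) _))
  set P := block L o (n + 1) x₀ with hP
  -- traces of the `η`-clusters of `x` on `B` and of `y` on `B'`
  set tr : Set (Sym2 (Site d) × Fin 2) → Finset (Site d) := fun ξ =>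
    B.filter fun z => (openGraph (η ξ)).Reachable x z with htr
  set tr' : Set (Sym2 (Site d) × Fin 2) → Finset (Site d) := fun ξ =>
    B'.filter fun z => (openGraph (η ξ)).Reachable y z with htr'
  have htr_card : ∀ ξ, ((tr ξ).card : ℝ) = clusterCapIn B (η ξ) x := fun ξ => by
    rw [clusterCapIn_eq]
  have htr'_card : ∀ ξ, ((tr' ξ).card : ℝ) = clusterCapIn B' (η ξ) y := fun ξ => by
    rw [clusterCapIn_eq]
  -- the fibres and the link events
  set S : Finset (Finset (Site d) × Finset (Site d)) := B.powerset ×ˢ B'.powerset with hS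
  set Fib : Finset (Site d) × Finset (Site d) → Set (Set (Sym2 (Site d) × Fin 2)) := fun D =>
    {ξ | tr ξ = D.1 ∧ tr' ξ = D.2} with hFib
  set LinkD : Finset (Site d) × Finset (Site d) → Set (Set (Sym2 (Site d) × Fin 2)) := fun D =>
    {ξ | ∃ a ∈ D.1, ∃ b ∈ D.2, (s(a, b), (1 : Fin 2)) ∈ ξ} with hLinkD
  -- the coordinates of the cross copies of `σ(B)`
  set T : Finset (Sym2 (Site d) × Fin 2) :=
    ((P ×ˢ P).filter fun ab => block L o n ab.1 ≠ block L o n ab.2).image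
      fun ab => (s(ab.1, ab.2), (1 : Fin 2)) with hT
  have hTmem : ∀ {a b : Site d}, a ∈ P → b ∈ P → block L o n a ≠ block L o n b →
      (s(a, b), (1 : Fin 2)) ∈ T := by
    intro a b ha hb hab
    exact Finset.mem_image.2 ⟨(a, b), Finset.mem_filter.2 ⟨Finset.mem_product.2 ⟨ha, hb⟩, hab⟩, rfl⟩
  have hTsub : ∀ k ∈ T, k.2 = 1 ∧ k.1 ∈ blockEdges L o (n + 1) x₀ := by
    intro k hk
    obtain ⟨⟨a, b⟩, hab, rfl⟩ := Finset.mem_image.1 hk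
    obtain ⟨hab, hblk⟩ := Finset.mem_filter.1 hab
    obtain ⟨ha, hb⟩ := Finset.mem_product.1 hab
    refine ⟨rfl, ?_⟩
    have hca : block L o n a ∈ children L o n x₀ := (mem_children_iff o).2 ⟨a, ha, rfl⟩
    have hcb : block L o n b ∈ children L o n x₀ := (mem_children_iff o).2 ⟨b, hb, rfl⟩
    exact mk_mem_blockEdges_of_children hL ho hca hcb hblk (mem_block_self hL1 o n a)
      (mem_block_self hL1 o n b)
  have hUT : {k : Sym2 (Site d) × Fin 2 | k.2 = 0 ∨ k.1 ∈ aboveFree L o B} ⊆ (↑T : Set _)ᶜ := by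
    intro k hk hkT
    obtain ⟨h2, h1⟩ := hTsub k hkT
    rcases hk with h' | h'
    · rw [h2] at h'; exact absurd h' (by decide)
    · exact blockEdges_succ_disjoint_aboveFree hL hd ho hB h1 h'
  -- Step 1: linked traces connect `x` to `y` in `η_{σ(B)} = η ∪ ω_{σ(B)}`
  have hxC : block L o n x₀ ∈ children L o n x₀ :=
    (mem_children_iff o).2 ⟨x₀, mem_block_self hL1 o _ x₀, rfl⟩
  have hsub : (⋃ D ∈ S, Fib D ∩ LinkD D) ⊆
      {ξ | (openGraph (etaCfg (aboveFree L o P) ξ)).Reachable x y} := by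
    intro ξ hξ
    simp only [Set.mem_iUnion, Set.mem_inter_iff, exists_prop] at hξ
    obtain ⟨D, -, hFD, hLD⟩ := hξ
    obtain ⟨a, ha, b, hb, hab⟩ := hLD
    simp only [hFib, Set.mem_setOf_eq] at hFD
    rw [← hFD.1] at ha
    rw [← hFD.2] at hb
    obtain ⟨haB, hxa⟩ := Finset.mem_filter.1 ha
    obtain ⟨hbB, hyb⟩ := Finset.mem_filter.1 hb
    have hsplit : etaCfg (aboveFree L o P) ξ = η ξ ∪ omegaLayer (blockEdges L o (n + 1) x₀) ξ := by
      rw [hP, etaCfg_aboveFree_succ hL ho hd n x₀ ξ, aboveFree_eq_of_children hL hd ho hxC hB]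
    show (openGraph (etaCfg (aboveFree L o P) ξ)).Reachable x y
    rw [hsplit]
    have hmono : openGraph (η ξ) ≤ openGraph (η ξ ∪ omegaLayer (blockEdges L o (n + 1) x₀) ξ) :=
      openGraph_mono Set.subset_union_left
    have hab' : a ≠ b := fun h' =>
      Finset.disjoint_left.1 (disjoint_of_mem_children hL1 hB hB' hne) haB (h' ▸ hbB)
    have hedge : s(a, b) ∈ omegaLayer (blockEdges L o (n + 1) x₀) ξ :=
      ⟨hab, mk_mem_blockEdges_of_children hL ho hB hB' hne haB hbB⟩
    have h2 : (openGraph (η ξ ∪ omegaLayer (blockEdges L o (n + 1) x₀) ξ)).Reachable a b :=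
      SimpleGraph.Adj.reachable ((openGraph_adj _ a b).2 ⟨Set.mem_union_right _ hedge, hab'⟩)
    exact ((hxa.mono hmono).trans h2).trans (hyb.mono hmono).symm
  -- Step 2: `P(⋃ Fib ∩ Link) = Σ P(Fib) (1 - exp(-h|D₁||D₂|))`
  have hFib_det : ∀ D ∈ S, DeterminedBy (Fib D) (↑T : Set _)ᶜ := fun D _ =>
    (determinedBy_preimage_etaCfg (aboveFree L o B)
      {ω | (B.filter fun z => (openGraph ω).Reachable x z) = D.1 ∧
        (B'.filter fun z => (openGraph ω).Reachable y z) = D.2}).mono hUT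
  have hLink_det : ∀ D ∈ S, DeterminedBy (LinkD D) ↑T := by
    intro D hD
    obtain ⟨hD1, hD2⟩ := Finset.mem_product.1 hD
    rw [Finset.mem_powerset] at hD1 hD2
    rw [determinedBy_iff]
    intro ξ ξ' hξ
    simp only [hLinkD, Set.mem_setOf_eq]
    refine exists_congr fun a => and_congr_right fun ha => exists_congr fun b =>
      and_congr_right fun hb => ?_
    have hk : (s(a, b), (1 : Fin 2)) ∈ T := by
      refine hTmem (subset_of_mem_children hL1 o ho hB (hD1 ha))
        (subset_of_mem_children hL1 o ho hB' (hD2 hb)) ?_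
      rw [block_eq_of_mem_children hL1 hB (hD1 ha), block_eq_of_mem_children hL1 hB' (hD2 hb)]
      exact hne
    have := Set.ext_iff.1 hξ (s(a, b), (1 : Fin 2))
    simp only [Set.mem_inter_iff, Finset.mem_coe, hk, and_true] at this
    exact this
  have hFib_meas : ∀ D ∈ S, MeasurableSet (Fib D) := fun D _ =>
    (measurable_etaCfg _)
      ((measurableSet_fiber_of_reach_congr B (fun ω => B.filter fun z => (openGraph ω).Reachable x z)
        (fun ω ω' hcongr => Finset.filter_congr fun z hz => hcongr x hx z hz) D.1).inter
      (measurableSet_fiber_of_reach_congr B' (fun ω => B'.filter fun z => (openGraph ω).Reachable y z)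
        (fun ω ω' hcongr => Finset.filter_congr fun z hz => hcongr y hy z hz) D.2))
  have hClosed_meas : ∀ D : Finset (Site d) × Finset (Site d),
      MeasurableSet {ξ : Set (Sym2 (Site d) × Fin 2) | ∀ a ∈ D.1, ∀ b ∈ D.2, (s(a, b), (1 : Fin 2)) ∉ ξ} := by
    intro D
    have : {ξ : Set (Sym2 (Site d) × Fin 2) | ∀ a ∈ D.1, ∀ b ∈ D.2, (s(a, b), (1 : Fin 2)) ∉ ξ} =
        ⋂ a ∈ D.1, ⋂ b ∈ D.2, {ξ | (s(a, b), (1 : Fin 2)) ∉ ξ} := by ext ξ; simp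
    rw [this]
    exact Finset.measurableSet_biInter _ fun a _ =>
      Finset.measurableSet_biInter _ fun b _ => measurableSet_notMem _
  have hLink_compl : ∀ D : Finset (Site d) × Finset (Site d),
      LinkD D = {ξ | ∀ a ∈ D.1, ∀ b ∈ D.2, (s(a, b), (1 : Fin 2)) ∉ ξ}ᶜ := by
    intro D; ext ξ; simp [hLinkD]
  have hLink_meas : ∀ D ∈ S, MeasurableSet (LinkD D) := fun D _ => by
    rw [hLink_compl]; exact (hClosed_meas D).compl
  have hdisj : (↑S : Set (Finset (Site d) × Finset (Site d))).PairwiseDisjoint Fib := by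
    intro D _ D' _ hne'
    rw [Function.onFun, Set.disjoint_left]
    intro ξ h1 h2
    apply hne'
    simp only [hFib, Set.mem_setOf_eq] at h1 h2
    exact Prod.ext (h1.1.symm.trans h2.1) (h1.2.symm.trans h2.2)
  have hdecomp := prodBernoulli_real_biUnion_inter_eq_sum (hierParam J L o c α β) T S Fib LinkD
    hFib_det hLink_det hFib_meas hLink_meas hdisj
  have hLinkP : ∀ D ∈ S, μ.real (LinkD D) = 1 - Real.exp (-(h * (D.1.card * D.2.card))) := by
    intro D hD
    obtain ⟨hD1, hD2⟩ := Finset.mem_product.1 hD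
    rw [Finset.mem_powerset] at hD1 hD2
    rw [hLink_compl, measureReal_compl (hClosed_meas D), probReal_univ,
      hierLaw_real_forall_cross_closed hL ho hc hβ hB hB' hne hD1 hD2]
  -- Step 3: the numerical inequality on each fibre
  set m : ℕ → ℝ := fun k => min (k : ℝ) τ with hm
  have hm0 : ∀ k, 0 ≤ m k := fun k => le_min (Nat.cast_nonneg _) hτ.le
  have hmτ : ∀ k, m k ≤ τ := fun k => min_le_right _ _
  have hnum : ∀ D : Finset (Site d) × Finset (Site d),
      (1 - Real.exp (-1)) * (h * (m D.1.card * m D.2.card)) ≤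
        1 - Real.exp (-(h * (D.1.card * D.2.card))) := by
    intro D
    have ht0 : 0 ≤ h * (m D.1.card * m D.2.card) := mul_nonneg hh0 (mul_nonneg (hm0 _) (hm0 _))
    have ht1 : h * (m D.1.card * m D.2.card) ≤ 1 := by
      calc h * (m D.1.card * m D.2.card) ≤ h * (τ * τ) :=
            mul_le_mul_of_nonneg_left (mul_le_mul (hmτ _) (hmτ _) (hm0 _) hτ.le) hh0
        _ = h * τ ^ 2 := by ring
        _ ≤ 1 := hτh
    have htle : h * (m D.1.card * m D.2.card) ≤ h * (D.1.card * D.2.card) :=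
      mul_le_mul_of_nonneg_left (mul_le_mul (min_le_left _ _) (min_le_left _ _) (hm0 _)
        (Nat.cast_nonneg _)) hh0
    calc (1 - Real.exp (-1)) * (h * (m D.1.card * m D.2.card))
        ≤ 1 - Real.exp (-(h * (m D.1.card * m D.2.card))) := one_sub_exp_neg_one_mul_le ht0 ht1
      _ ≤ 1 - Real.exp (-(h * (D.1.card * D.2.card))) := by
          linarith [Real.exp_le_exp.2 (neg_le_neg htle)]
  -- Step 4: the integrand `(|C(x)| ∧ τ)(|C'(y)| ∧ τ)` is constant on the fibres
  have hF : ∀ ξ, m (clusterCapIn B (η ξ) x) * m (clusterCapIn B' (η ξ) y) =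
      ∑ D ∈ S, (m D.1.card * m D.2.card) * (Fib D).indicator (fun _ => (1 : ℝ)) ξ := by
    intro ξ
    have hmem : (tr ξ, tr' ξ) ∈ S := Finset.mem_product.2
      ⟨Finset.mem_powerset.2 (Finset.filter_subset _ _), Finset.mem_powerset.2 (Finset.filter_subset _ _)⟩
    rw [Finset.sum_eq_single_of_mem (tr ξ, tr' ξ) hmem]
    · rw [Set.indicator_of_mem (show ξ ∈ Fib (tr ξ, tr' ξ) from ⟨rfl, rfl⟩), mul_one]
      simp only [hm]
      rw [htr_card, htr'_card]
    · intro D _ hD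
      rw [Set.indicator_of_notMem, mul_zero]
      intro h'
      apply hD
      simp only [hFib, Set.mem_setOf_eq] at h'
      exact Prod.ext h'.1.symm h'.2.symm
  have hintF : ∫ ξ, m (clusterCapIn B (η ξ) x) * m (clusterCapIn B' (η ξ) y) ∂μ =
      ∑ D ∈ S, (m D.1.card * m D.2.card) * μ.real (Fib D) := by
    simp_rw [hF]
    rw [integral_finsetSum _ fun D hD => ((integrable_const (1 : ℝ)).indicator (hFib_meas D hD)).const_mul _]
    refine Finset.sum_congr rfl fun D hD => ?_
    rw [integral_const_mul, integral_indicator_const _ (hFib_meas D hD), smul_eq_mul, mul_one]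
  -- Step 5: Harris for the two truncated trace sizes (increasing step functions of `ξ`)
  set A₁ : ℕ → Set (Set (Sym2 (Site d) × Fin 2)) := fun s => η ⁻¹' {ω | s + 1 ≤ clusterCapIn B ω x} with hA₁
  set A₂ : ℕ → Set (Set (Sym2 (Site d) × Fin 2)) := fun s => η ⁻¹' {ω | s + 1 ≤ clusterCapIn B' ω y} with hA₂
  set cf : ℕ → ℝ := fun s => min ((s : ℝ) + 1) τ - min (s : ℝ) τ with hcf
  have hstep₁ : ∀ ξ, m (clusterCapIn B (η ξ) x) = ∑ s ∈ Finset.range B.card, cf s * (A₁ s).indicator (fun _ => (1 : ℝ)) ξ := by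
    intro ξ
    simp only [hm, hA₁, indicator_preimage_const_one]
    exact min_clusterCapIn_eq_sum_indicator B (η ξ) x hτ.le
  have hstep₂ : ∀ ξ, m (clusterCapIn B' (η ξ) y) = ∑ s ∈ Finset.range B'.card, cf s * (A₂ s).indicator (fun _ => (1 : ℝ)) ξ := by
    intro ξ
    simp only [hm, hA₂, indicator_preimage_const_one]
    exact min_clusterCapIn_eq_sum_indicator B' (η ξ) y hτ.le
  have hA₁up : ∀ s, IsUpperSet (A₁ s) := fun s =>
    (isUpperSet_clusterCapIn_ge B x (s + 1)).preimage (etaCfg_mono _)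
  have hA₂up : ∀ s, IsUpperSet (A₂ s) := fun s =>
    (isUpperSet_clusterCapIn_ge B' y (s + 1)).preimage (etaCfg_mono _)
  have hA₁m : ∀ s, MeasurableSet (A₁ s) := fun s => (measurable_etaCfg _) (measurableSet_clusterCapIn_ge B x (s + 1))
  have hA₂m : ∀ s, MeasurableSet (A₂ s) := fun s => (measurable_etaCfg _) (measurableSet_clusterCapIn_ge B' y (s + 1))
  have hHarris : (∫ ξ, m (clusterCapIn B (η ξ) x) ∂μ) * (∫ ξ, m (clusterCapIn B' (η ξ) y) ∂μ) ≤
      ∫ ξ, m (clusterCapIn B (η ξ) x) * m (clusterCapIn B' (η ξ) y) ∂μ := by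
    simp_rw [hstep₁, hstep₂]
    exact prodBernoulli_integral_stepFun_mul_ge (hierParam J L o c α β) (Finset.range B.card)
      (Finset.range B'.card) cf cf A₁ A₂ (fun s _ => min_succ_sub_min_nonneg s τ)
      (fun s _ => min_succ_sub_min_nonneg s τ) (fun s _ => hA₁up s) (fun s _ => hA₁m s)
      (fun s _ => hA₂up s) (fun s _ => hA₂m s)
  -- Step 6: assemble
  have hI₁ : 0 ≤ ∫ ξ, m (clusterCapIn B (η ξ) x) ∂μ := integral_nonneg fun ξ => hm0 _
  have hI₂ : 0 ≤ ∫ ξ, m (clusterCapIn B' (η ξ) y) ∂μ := integral_nonneg fun ξ => hm0 _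
  have he1 : 0 ≤ 1 - Real.exp (-1) := by
    have : Real.exp (-1) ≤ 1 := Real.exp_le_one_iff.2 (by norm_num)
    linarith
  calc (1 - Real.exp (-1)) * h *
        ((∫ ξ, m (clusterCapIn B (η ξ) x) ∂μ) * (∫ ξ, m (clusterCapIn B' (η ξ) y) ∂μ))
      ≤ (1 - Real.exp (-1)) * h * ∫ ξ, m (clusterCapIn B (η ξ) x) * m (clusterCapIn B' (η ξ) y) ∂μ :=
        mul_le_mul_of_nonneg_left hHarris (mul_nonneg he1 hh0)
    _ = ∑ D ∈ S, (1 - Real.exp (-1)) * (h * (m D.1.card * m D.2.card)) * μ.real (Fib D) := by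
        rw [hintF, Finset.mul_sum]
        refine Finset.sum_congr rfl fun D _ => ?_
        ring
    _ ≤ ∑ D ∈ S, (1 - Real.exp (-(h * (D.1.card * D.2.card)))) * μ.real (Fib D) :=
        Finset.sum_le_sum fun D _ => mul_le_mul_of_nonneg_right (hnum D) measureReal_nonneg
    _ = ∑ D ∈ S, μ.real (Fib D) * μ.real (LinkD D) := by
        refine Finset.sum_congr rfl fun D hD => ?_
        rw [hLinkP D hD, mul_comm]
    _ = μ.real (⋃ D ∈ S, Fib D ∩ LinkD D) := hdecomp.symm
    _ ≤ μ.real {ξ | (openGraph (etaCfg (aboveFree L o P) ξ)).Reachable x y} :=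
        measureReal_mono hsub (measure_ne_top _ _)

end Lemma28

section Lemma28Assembly

open MeasureTheory

variable {V : Type*}

/-- `|K_max|` is monotone in the region and in the configuration. [folklore] -/
theorem clusterMaxIn_le_of_subset {Λ Λ' : Finset V} (hΛ : Λ ⊆ Λ') {ω ω' : BondConfig V}
    (hω : ω ⊆ ω') : clusterMaxIn Λ ω ≤ clusterMaxIn Λ' ω' := by
  classical
  refine Finset.sup_le fun v hv => le_trans ?_ (clusterCapIn_le_clusterMaxIn (hΛ hv) ω')
  rw [clusterCapIn_eq, clusterCapIn_eq]
  exact Finset.card_le_card fun z hz => Finset.mem_filter.2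
    ⟨hΛ (Finset.mem_filter.1 hz).1, (Finset.mem_filter.1 hz).2.mono (openGraph_mono hω)⟩

/-- **Comparison of typical maxima**: if `P_μ(|K_max(Λ)| ≥ m) ≤ P_ν(|K_max(Λ')| ≥ m)` for all `m`
then `M_μ(Λ) ≤ M_ν(Λ')`. [cite: Hutchcroft2022, proof of Lemma 2.8 ("since … M_{B'} ≤ M_{σ(B)}")] -/
theorem typicalMax_le_of_real_le {W : Type*} (μ : Measure (BondConfig V)) (ν : Measure (BondConfig W))
    (Λ : Finset V) (Λ' : Finset W)
    (h : ∀ m : ℕ, μ.real {ω | m ≤ clusterMaxIn Λ ω} ≤ ν.real {ω | m ≤ clusterMaxIn Λ' ω}) :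
    typicalMax μ Λ ≤ typicalMax ν Λ' :=
  Nat.sInf_le ((h _).trans (real_typicalMax_le_clusterMaxIn_le ν Λ'))

variable {L : ℕ} (hL : 2 ≤ L) (hd : 1 ≤ d) {o : ℕ → Site d} (ho : IsHierOffset L o)
  {J : Sym2 (Site d) → ℝ} {c α β : ℝ}

include hL hd ho in
/-- **`M_B ≤ M_{σ(B)}` for a child `B` of `σ(B)`** (`η_B ⊆ η_{σ(B)}` by (2.4) and `B ⊆ σ(B)`).
[cite: Hutchcroft2022, proof of Lemma 2.8 ("M_{B'} ≤ M_{σ(B)}")] -/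
theorem Mblock_le_parent {n : ℕ} {x₀ : Site d} {B : Finset (Site d)} (hB : B ∈ children L o n x₀) :
    Mblock J L o c α β B ≤ Mblock J L o c α β (block L o (n + 1) x₀) := by
  classical
  have hL1 : 1 ≤ L := le_trans (by norm_num) hL
  have hxC : block L o n x₀ ∈ children L o n x₀ :=
    (mem_children_iff o).2 ⟨x₀, mem_block_self hL1 o _ x₀, rfl⟩
  refine typicalMax_le_of_real_le _ _ _ _ fun m => ?_
  rw [etaLaw, etaLaw, measureReal_def, measureReal_def,
    Measure.map_apply (measurable_etaCfg _) (measurableSet_clusterMaxIn_ge B m),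
    Measure.map_apply (measurable_etaCfg _) (measurableSet_clusterMaxIn_ge _ m)]
  refine ENNReal.toReal_mono (measure_ne_top _ _) (measure_mono fun ξ hξ => ?_)
  simp only [Set.mem_preimage, Set.mem_setOf_eq] at hξ ⊢
  rw [etaCfg_aboveFree_succ hL ho hd n x₀ ξ, aboveFree_eq_of_children hL hd ho hxC hB]
  exact hξ.trans (clusterMaxIn_le_of_subset (subset_of_mem_children hL1 o ho hB) Set.subset_union_left)

/-- `sumConn ≥ 0`. [folklore] -/
theorem sumConn_nonneg (B : Finset (Site d)) : 0 ≤ sumConn J L o c α β B :=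
  Finset.sum_nonneg fun _ _ => Finset.sum_nonneg fun _ _ => measureReal_nonneg

include hL hd ho in
/-- **Lemma 2.8, one step of the susceptibility renormalisation** (explicit form): for distinct
children `B, B'` of `σ(B)`, `h = cβL^{-(d+α)(n+1)}` and any `τ > 0` with `hτ² ≤ 1`,
`Σ_{x,y ∈ σ(B)} P(x ↔ y in η_{σ(B)}) ≥ ¼(1-e^{-1}) h κ_B κ_{B'} · Σ_{x,y∈B} P(x ↔ y in η_B) ·
Σ_{x,y∈B'} P(x ↔ y in η_{B'})` with `κ_C = min(1, τ/(10 M_C))` (the pair inequality summed over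
`x ∈ B`, `y ∈ B'`, then Lemma 2.9 for the truncated susceptibilities; the printed statement takes
the sibling `B'` with the larger susceptibility, `τ = h^{-1/2}` and bounds `M_B, M_{B'}` by
Prop. 2.4). [cite: Hutchcroft2022, Lemma 2.8 and its proof (pp. 11–12)] -/
theorem sumConn_parent_ge (hc : 0 ≤ c) (hα : 0 ≤ (d : ℝ) + α) (hJ0 : ∀ e, 0 ≤ J e)
    (hJ : HasPowerLowerBound J c α) (hβ : 0 ≤ β) {n : ℕ} {x₀ : Site d} {B B' : Finset (Site d)}
    (hB : B ∈ children L o n x₀) (hB' : B' ∈ children L o n x₀) (hne : B ≠ B') {τ : ℝ} (hτ : 0 < τ)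
    (hτh : β * (c * ((L : ℝ) ^ (n + 1)) ^ (-((d : ℝ) + α))) * τ ^ 2 ≤ 1) :
    (1 - Real.exp (-1)) / 4 * (β * (c * ((L : ℝ) ^ (n + 1)) ^ (-((d : ℝ) + α)))) *
        (min 1 (τ / (10 * (Mblock J L o c α β B : ℝ))) * min 1 (τ / (10 * (Mblock J L o c α β B' : ℝ)))) *
        (sumConn J L o c α β B * sumConn J L o c α β B') ≤
      sumConn J L o c α β (block L o (n + 1) x₀) := by
  classical
  have hL1 : 1 ≤ L := le_trans (by norm_num) hL
  set μ := hierLaw J L o c α β with hμ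
  haveI : IsProbabilityMeasure μ := by rw [hμ]; infer_instance
  set η : Set (Sym2 (Site d) × Fin 2) → BondConfig (Site d) := etaCfg (aboveFree L o B) with hη
  set h : ℝ := β * (c * ((L : ℝ) ^ (n + 1)) ^ (-((d : ℝ) + α))) with hh
  have hh0 : 0 ≤ h := mul_nonneg hβ (mul_nonneg hc (Real.rpow_nonneg (pow_nonneg (Nat.cast_nonneg _) _) _))
  set P := block L o (n + 1) x₀ with hP
  have hBne : B.Nonempty := nonempty_of_mem_children hL1 hB
  have hB'ne : B'.Nonempty := nonempty_of_mem_children hL1 hB'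
  set I₁ : Site d → ℝ := fun x => ∫ ξ, min (clusterCapIn B (η ξ) x : ℝ) τ ∂μ with hI₁
  set I₂ : Site d → ℝ := fun y => ∫ ξ, min (clusterCapIn B' (η ξ) y : ℝ) τ ∂μ with hI₂
  set κ₁ : ℝ := min 1 (τ / (10 * (Mblock J L o c α β B : ℝ))) with hκ₁
  set κ₂ : ℝ := min 1 (τ / (10 * (Mblock J L o c α β B' : ℝ))) with hκ₂
  have hκ₁0 : 0 ≤ κ₁ := le_min zero_le_one (div_nonneg hτ.le (by positivity))
  have hκ₂0 : 0 ≤ κ₂ := le_min zero_le_one (div_nonneg hτ.le (by positivity))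
  have hI₁0 : ∀ x, 0 ≤ I₁ x := fun x => integral_nonneg fun ξ => le_min (Nat.cast_nonneg _) hτ.le
  have hI₂0 : ∀ y, 0 ≤ I₂ y := fun y => integral_nonneg fun ξ => le_min (Nat.cast_nonneg _) hτ.le
  -- (i) Lemma 2.9 for `B`
  have h1 : (1 / 2) * κ₁ * sumConn J L o c α β B ≤ ∑ x ∈ B, I₁ x := by
    obtain ⟨K, hK⟩ : ∃ K, etaLaw J L o c α β B = kernelPercolation K β :=
      ⟨_, etaLaw_eq hL ho hc hα hJ0 hJ hβ B⟩
    unfold sumConn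
    rw [Finset.mul_sum]
    refine Finset.sum_le_sum fun x _ => ?_
    have hI : I₁ x = ∫ ω, min (clusterCapIn B ω x : ℝ) τ ∂(etaLaw J L o c α β B) := by
      simp only [hI₁, hη]
      rw [etaLaw, integral_map (measurable_etaCfg _).aemeasurable]
      exact (integrable_min_clusterCapIn _ B x hτ.le).aestronglyMeasurable
    have hE : ∑ y ∈ B, (etaLaw J L o c α β B).real (openConn x y) =
        ∫ ω, (clusterCapIn B ω x : ℝ) ∂(etaLaw J L o c α β B) := (integral_clusterCapIn_eq_sum _ B x).symm
    have hM : (Mblock J L o c α β B : ℝ) = typicalMax (kernelPercolation K β) B := by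
      rw [Mblock, hK]
    rw [hI, hE, hκ₁, hM, hK]
    exact integral_min_clusterCapIn_ge _ hBne x hτ
  -- (i') Lemma 2.9 for `B'` (`η_{B'} = η_B`)
  have h2 : (1 / 2) * κ₂ * sumConn J L o c α β B' ≤ ∑ y ∈ B', I₂ y := by
    obtain ⟨K', hK'⟩ : ∃ K', etaLaw J L o c α β B' = kernelPercolation K' β :=
      ⟨_, etaLaw_eq hL ho hc hα hJ0 hJ hβ B'⟩
    have hAB : aboveFree L o B = aboveFree L o B' := aboveFree_eq_of_children hL hd ho hB hB'
    unfold sumConn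
    rw [Finset.mul_sum]
    refine Finset.sum_le_sum fun y _ => ?_
    have hI : I₂ y = ∫ ω, min (clusterCapIn B' ω y : ℝ) τ ∂(etaLaw J L o c α β B') := by
      simp only [hI₂, hη, hAB]
      rw [etaLaw, integral_map (measurable_etaCfg _).aemeasurable]
      exact (integrable_min_clusterCapIn _ B' y hτ.le).aestronglyMeasurable
    have hE : ∑ z ∈ B', (etaLaw J L o c α β B').real (openConn y z) =
        ∫ ω, (clusterCapIn B' ω y : ℝ) ∂(etaLaw J L o c α β B') := (integral_clusterCapIn_eq_sum _ B' y).symm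
    have hM : (Mblock J L o c α β B' : ℝ) = typicalMax (kernelPercolation K' β) B' := by
      rw [Mblock, hK']
    rw [hI, hE, hκ₂, hM, hK']
    exact integral_min_clusterCapIn_ge _ hB'ne y hτ
  -- (ii) the sub-sum over `B × B'`
  have h3 : ∑ x ∈ B, ∑ y ∈ B', μ.real {ξ | (openGraph (etaCfg (aboveFree L o P) ξ)).Reachable x y} ≤
      sumConn J L o c α β P := by
    have hBP : B ⊆ P := subset_of_mem_children hL1 o ho hB
    have hB'P : B' ⊆ P := subset_of_mem_children hL1 o ho hB'
    have hterm : ∀ x y, μ.real {ξ | (openGraph (etaCfg (aboveFree L o P) ξ)).Reachable x y} =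
        (etaLaw J L o c α β P).real (openConn x y) := fun x y => by
      rw [etaLaw, measureReal_def, measureReal_def,
        Measure.map_apply (measurable_etaCfg _) (measurableSet_openConn_holds x y)]
      rfl
    simp_rw [hterm]
    unfold sumConn
    calc ∑ x ∈ B, ∑ y ∈ B', (etaLaw J L o c α β P).real (openConn x y)
        ≤ ∑ x ∈ B, ∑ y ∈ P, (etaLaw J L o c α β P).real (openConn x y) :=
          Finset.sum_le_sum fun x _ => Finset.sum_le_sum_of_subset_of_nonneg hB'P
            fun _ _ _ => measureReal_nonneg
      _ ≤ ∑ x ∈ P, ∑ y ∈ P, (etaLaw J L o c α β P).real (openConn x y) :=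
          Finset.sum_le_sum_of_subset_of_nonneg hBP fun _ _ _ =>
            Finset.sum_nonneg fun _ _ => measureReal_nonneg
  -- (iii) the pair inequality
  have h4 : ∀ x ∈ B, ∀ y ∈ B', (1 - Real.exp (-1)) * h * (I₁ x * I₂ y) ≤
      μ.real {ξ | (openGraph (etaCfg (aboveFree L o P) ξ)).Reachable x y} := fun x hx y hy =>
    hierLaw_real_reachable_parent_ge hL hd ho hc hβ hB hB' hne hx hy hτ hτh
  -- (iv) assemble
  have he1 : 0 ≤ 1 - Real.exp (-1) := by
    have : Real.exp (-1) ≤ 1 := Real.exp_le_one_iff.2 (by norm_num)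
    linarith
  have hS0 : 0 ≤ sumConn J L o c α β B := sumConn_nonneg B
  have hS0' : 0 ≤ sumConn J L o c α β B' := sumConn_nonneg B'
  calc (1 - Real.exp (-1)) / 4 * h * (κ₁ * κ₂) * (sumConn J L o c α β B * sumConn J L o c α β B')
      = (1 - Real.exp (-1)) * h * (((1 / 2) * κ₁ * sumConn J L o c α β B) *
          ((1 / 2) * κ₂ * sumConn J L o c α β B')) := by ring
    _ ≤ (1 - Real.exp (-1)) * h * ((∑ x ∈ B, I₁ x) * (∑ y ∈ B', I₂ y)) := by
        apply mul_le_mul_of_nonneg_left _ (mul_nonneg he1 hh0)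
        exact mul_le_mul h1 h2 (by positivity) (Finset.sum_nonneg fun x _ => hI₁0 x)
    _ = ∑ x ∈ B, ∑ y ∈ B', (1 - Real.exp (-1)) * h * (I₁ x * I₂ y) := by
        rw [Finset.sum_mul_sum, Finset.mul_sum]
        refine Finset.sum_congr rfl fun x _ => ?_
        rw [Finset.mul_sum]
    _ ≤ ∑ x ∈ B, ∑ y ∈ B', μ.real {ξ | (openGraph (etaCfg (aboveFree L o P) ξ)).Reachable x y} :=
        Finset.sum_le_sum fun x hx => Finset.sum_le_sum fun y hy => h4 x hx y hy
    _ ≤ sumConn J L o c α β P := h3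

end Lemma28Assembly


end Literature.Probability.Percolation

end
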